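import Summits.ABC.IUTFork.Joshi.TestDictionaryCalibrationPlaces
import HarnessLib

/-!
# Branch E TEST vs S — the calibration across places, V: place-separability = «(Ind1)/(Ind2) may be applied ONE PLACE AT A TIME»

Record file of the abc-iut cell, branch E (rung LADDER-ABC:A2.E; seat abc-iut-E-t42 gen 2, row T-42f; sequel of
`Joshi/TestDictionaryCalibrationPlaces.lean` p438822). **No side is taken** on [IUTchIII] Cor. 3.12 or on any author; typed ≠ proved;
located, not adjudicated.

THE PRINT-FACING FORM OF THE HYPOTHESIS. Part I's `IndPlaceSeparable L` («a family assembled place by place from elements of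
`⟨(Ind1) ∪ (Ind2)⟩` lies in `⟨(Ind1) ∪ (Ind2)⟩`») decides whether X-01's one-indeterminacy language says more than S. THIS FILE restates it,
at every index with FINITELY many places, as the question a reader of [IUTchIII] Thm. 3.11 (i) can put to the text directly:
**may an indeterminacy be applied at ONE place at a time?** — i.e. is the SINGLE-PLACE COMPONENT `placeComponent Φ v_ℚ⁰` («`Φ` at
`v_ℚ⁰`, the identity at every other place») of every member `Φ` of `⟨(Ind1) ∪ (Ind2)⟩` again a member (`PlaceComponentsMem L`)?
* `placeComponentsMem_of_indPlaceSeparable` — at every index (a single-place component is a place-by-place assembly of `Φ` and `1`);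
* `indPlaceSeparable_of_placeComponentsMem` — at every index with `Finite T.VQ` (a place-by-place assembly is the finite product of
  the single-place components of its constituents; Finset induction);
* **`indPlaceSeparable_iff_placeComponentsMem`** `[Finite T.VQ]`;
* `TwoPlace.not_placeComponentsMem` — at part I's two-place rigid shells the single-place component of the diagonal swap family
  (`capsPermFamily sw` at `v_ℚ¹`, identity at `v_ℚ⁰` — literally part I's `mixed`) is NOT a member: (Ind1)'s capsule permutation
  ([IUTchIII] Thm. 3.11 (i) p. 154 «automorphisms of the procession of 𝒟⊢-prime-strips»; `LogShells.Ind1`: ONE `σ` for all `v_ℚ`)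
  cannot be applied at one place only. (For (Ind2) alone the answer is YES at every index: «independent copies of Ism at each `v_ℚ`»,
  `LogShells.Ind2Family` is a product over the places — `placeComponent_mem_Ind2Family`.)
So the located question behind «S as typed is packet-local» (parts I–IV) reads, for the faithfulness lanes: does print's «regarded up to
(Ind1), (Ind2)» allow the procession automorphism to differ from place to place (then S-as-typed = the uniform form), or is it ONE
automorphism of the procession (then the uniform form is the print-shaped one and S-as-typed is weaker off place-separable indices)?
E-cx-2 (INFO 1, 2026-08-26T11:13:21Z) reads the latter. [claim: Mochizuki2012, status: disputed] [claim: Joshi2024ATS3, status: disputed]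
-/

noncomputable section

open Set

namespace Summit.ABC.IUTFork.Joshi

open Thm311 Cor312 Cor312Vol Literature.IUT.LogThetaLattice

section Placewise

variable {T : ThetaIndex} (L : LogShells T)

open scoped Classical in
/-- **The SINGLE-PLACE COMPONENT** of a packet-automorphism family: `Φ` at the place `v_ℚ⁰`, the identity everywhere else. [folklore] -/
def _root_.Summit.ABC.IUTFork.Thm311.LogShells.placeComponent (Φ : L.PacketAut) (vQ₀ : T.VQ) : L.PacketAut :=
  fun j vQ => if vQ = vQ₀ then Φ j vQ else LinearEquiv.refl ℚ _

/-- At `v_ℚ⁰` the component is `Φ`. [folklore] -/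
theorem _root_.Summit.ABC.IUTFork.Thm311.LogShells.placeComponent_self (Φ : L.PacketAut) (vQ₀ : T.VQ) (j : T.Label) :
    L.placeComponent Φ vQ₀ j vQ₀ = Φ j vQ₀ := by
  simp [LogShells.placeComponent]

/-- Away from `v_ℚ⁰` the component is the identity. [folklore] -/
theorem _root_.Summit.ABC.IUTFork.Thm311.LogShells.placeComponent_of_ne (Φ : L.PacketAut) {vQ₀ vQ : T.VQ} (h : vQ ≠ vQ₀) (j : T.Label) :
    L.placeComponent Φ vQ₀ j vQ = LinearEquiv.refl ℚ _ := by
  simp [LogShells.placeComponent, h]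

/-- **`PlaceComponentsMem L` — «an indeterminacy may be applied at ONE place at a time»**: the single-place components of every member
of `⟨(Ind1) ∪ (Ind2)⟩` are members. TEST SHAPE on the signature, never asserted; no author claims it ([IUTchIII] Thm. 3.11 (i) p. 154
prints (Ind2) placewise — «for each `v_ℚ` … independent copies of Ism» — and (Ind1) as automorphisms of the procession).
[claim: Mochizuki2012, status: disputed] -/
@[claim "Mochizuki2012" "disputed"]
def _root_.Summit.ABC.IUTFork.Thm311.LogShells.PlaceComponentsMem : Prop :=
  ∀ Φ ∈ Subgroup.closure (L.Ind1Family ∪ L.Ind2Family), ∀ vQ₀ : T.VQ,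
    L.placeComponent Φ vQ₀ ∈ Subgroup.closure (L.Ind1Family ∪ L.Ind2Family)

/-- **(Ind2) alone may always be applied one place at a time**: the single-place component of an (Ind2)-family is an (Ind2)-family
(the identity lies in `Ind2 j v_ℚ`, `refl_mem_Ind2`). [claim: Mochizuki2012, status: disputed] -/
theorem _root_.Summit.ABC.IUTFork.Thm311.LogShells.placeComponent_mem_Ind2Family {Φ : L.PacketAut} (hΦ : Φ ∈ L.Ind2Family) (vQ₀ : T.VQ) :
    L.placeComponent Φ vQ₀ ∈ L.Ind2Family := fun j vQ => by
  by_cases h : vQ = vQ₀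
  · subst h; rw [L.placeComponent_self]; exact hΦ j vQ
  · rw [L.placeComponent_of_ne Φ h]; exact L.refl_mem_Ind2 j vQ

variable {L}

/-- **Place-separable ⟹ single-place components are members** (every index): the component is the place-by-place assembly of the
members `Φ` (at `v_ℚ⁰`) and `1` (elsewhere). [folklore] -/
theorem placeComponentsMem_of_indPlaceSeparable (hsep : IndPlaceSeparable L) : L.PlaceComponentsMem := by
  classical
  intro Φ hΦ vQ₀
  have hmem : ∀ vQ, (if vQ = vQ₀ then Φ else (1 : L.PacketAut)) ∈ Subgroup.closure (L.Ind1Family ∪ L.Ind2Family) :=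
    fun vQ => by split_ifs <;> [exact hΦ; exact one_mem _]
  have heq : (fun j vQ => (if vQ = vQ₀ then Φ else (1 : L.PacketAut)) j vQ) = L.placeComponent Φ vQ₀ := by
    funext j vQ
    by_cases h : vQ = vQ₀
    · subst h; rw [if_pos rfl, L.placeComponent_self]
    · rw [if_neg h, L.placeComponent_of_ne Φ h]; rfl
  rw [← heq]
  exact hsep _ hmem

open scoped Classical in
/-- The PARTIAL ASSEMBLY of a place-indexed family over a finite set `s` of places: `Φ_{v_ℚ}` at `v_ℚ ∈ s`, identity elsewhere. [folklore] -/
def partialAssembly (Φ : T.VQ → L.PacketAut) (s : Finset T.VQ) : L.PacketAut :=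
  fun j vQ => if vQ ∈ s then Φ vQ j vQ else LinearEquiv.refl ℚ _

/-- Over the empty set the partial assembly is the identity. [folklore] -/
theorem partialAssembly_empty (Φ : T.VQ → L.PacketAut) : partialAssembly Φ ∅ = 1 := by
  funext j vQ; simp [partialAssembly]; rfl

open scoped Classical in
/-- Inserting a place multiplies the partial assembly by the single-place component there. [folklore] -/
theorem partialAssembly_insert (Φ : T.VQ → L.PacketAut) {a : T.VQ} {s : Finset T.VQ} (ha : a ∉ s) :
    partialAssembly Φ (insert a s) = L.placeComponent (Φ a) a * partialAssembly Φ s := by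
  classical
  funext j vQ
  rw [Pi.mul_apply, Pi.mul_apply]
  by_cases h : vQ = a
  · subst h
    rw [L.placeComponent_self]
    simp only [partialAssembly, Finset.mem_insert, true_or, if_true, ha, if_false]
    rfl
  · rw [L.placeComponent_of_ne _ h]
    simp only [partialAssembly, Finset.mem_insert, h, false_or]
    rfl

/-- Every partial assembly of members is a member, given that single-place components of members are members. [folklore] -/
theorem partialAssembly_mem (hpc : L.PlaceComponentsMem) (Φ : T.VQ → L.PacketAut)
    (hΦ : ∀ vQ, Φ vQ ∈ Subgroup.closure (L.Ind1Family ∪ L.Ind2Family)) (s : Finset T.VQ) :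
    partialAssembly Φ s ∈ Subgroup.closure (L.Ind1Family ∪ L.Ind2Family) := by
  classical
  induction s using Finset.induction_on with
  | empty => rw [partialAssembly_empty]; exact one_mem _
  | insert a s ha ih => rw [partialAssembly_insert Φ ha]; exact mul_mem (hpc _ (hΦ a) a) ih

/-- **Single-place components are members ⟹ place-separable**, at every index with FINITELY many places (the full assembly is the
partial assembly over all places). [folklore] -/
theorem indPlaceSeparable_of_placeComponentsMem [Finite T.VQ] (hpc : L.PlaceComponentsMem) : IndPlaceSeparable L := by
  classical
  haveI := Fintype.ofFinite T.VQ
  intro Φ hΦ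
  have heq : (fun j vQ => Φ vQ j vQ) = partialAssembly Φ Finset.univ := by
    funext j vQ; simp [partialAssembly]
  rw [heq]
  exact partialAssembly_mem hpc Φ hΦ _

/-- **`indPlaceSeparable_iff_placeComponentsMem`** — at every index with finitely many places: `⟨(Ind1) ∪ (Ind2)⟩` is place-separable
IFF an indeterminacy may be applied one place at a time. [claim: Mochizuki2012, status: disputed] -/
theorem indPlaceSeparable_iff_placeComponentsMem [Finite T.VQ] : IndPlaceSeparable L ↔ L.PlaceComponentsMem :=
  ⟨placeComponentsMem_of_indPlaceSeparable, indPlaceSeparable_of_placeComponentsMem⟩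

end Placewise

/-! ## At the two-place rigid shells: (Ind1)'s capsule permutation can NOT be applied at one place only -/

namespace TwoPlace

/-- Part I's `mixed` family IS the single-place component at `v_ℚ¹` of the diagonal swap family. [folklore] -/
theorem mixed_eq_placeComponent : mixed = shells.placeComponent (shells.capsPermFamily sw) true := by
  funext j vQ
  cases vQ
  · rw [shells.placeComponent_of_ne _ (show (false : Bool) ≠ true by decide)]; rfl
  · rw [shells.placeComponent_self]; rfl

/-- **`not_placeComponentsMem`** — at the two-place rigid shells an (Ind1)-family (the diagonal swap `capsPermFamily sw`) has a
single-place component OUTSIDE `⟨(Ind1) ∪ (Ind2)⟩` (part I `mixed_not_mem`): the capsule permutation cannot be applied at `v_ℚ¹` alone.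
[claim: Mochizuki2012, status: disputed] -/
theorem not_placeComponentsMem : ¬ shells.PlaceComponentsMem := fun h =>
  mixed_not_mem (mixed_eq_placeComponent ▸ h _ (shells.capsPermFamily_mem_closure sw) true)

/-- … equivalently (two places are finitely many) part I's `not_indPlaceSeparable`, re-derived through the iff. [folklore] -/
theorem not_indPlaceSeparable' : ¬ IndPlaceSeparable shells := fun h =>
  haveI : Finite index.VQ := inferInstanceAs (Finite Bool)
  not_placeComponentsMem (placeComponentsMem_of_indPlaceSeparable h)

end TwoPlace

end Summit.ABC.IUTFork.Joshi

end
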